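import Literature.MathematicalPhysics.QuantumFieldTheory.Balaban1983to89.B4Thm19ZeroTorus
import Literature.MathematicalPhysics.QuantumFieldTheory.Balaban1983to89.B4Thm110ZeroTorusUniform

/-!
# B4 «Theorem (Proposition 2.1 of [1])», the Hölder clause (1.9), at `A = 0` on the torus — with the constants UNIFORM IN THE
# MASS `0 ≤ m² ≤ m₀²` (the print's «depending on d, M only, c₀ on α also»): a re-run of `B4Thm19ZeroTorus.thm19_zero_torus`
# with the mass quantified inside

Sequel of `B4Thm19ZeroTorus` (lit-balaban Phase-2 seat p38 g4; route pp. 582–584 (2.34), (2.38)–(2.39) + Lemma 2.4 (2.36) + the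
`C^{(0)}` kernel) and twin of `B4Thm110ZeroTorusUniform` (the clauses (1.10) with the mass inside), typed by seat
`pub-ymgap-dag-n15-e` (generation 9) of the cell `pub-ymgap` (Track-A node N15 = NE2, King-model rung), which needs the mass
uniformity to run King's (2.17) peel over scales (the level-`j` piece carries the mass `m²(L^jη)²`, King (2.20)) for the
C^{1,α} layer of the full `A = 0` fluctuation propagator.
B4 = T. Bałaban, *Regularity and decay of lattice Green's functions*, Commun. Math. Phys. **89** (1983) 571–597
[cite: Balaban1983RegularityDecay] (journal page = PDF page + 570).

## WHAT IS PRINTED (verbatim, p. 573 [PDF 3]; `≦` written `≤`)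

«**Theorem** (Proposition 2.1 of [1]). For α < 1 there exist positive constants δ₀, c₀, R₀ independent of A, k, Ω and depending on
d, M only, c₀ on α also, such that for e sufficiently small and for an arbitrary function f : Ω → R^N, we have
(1/|x − x′|^α)|U(A(Γ_{x,x′}))(D^η_{A,μ}G_k(Ω, A)f)(x′) − (D^η_{A,μ}G_k(Ω, A)f)(x)| ≤ c₀exp(−δ₀ dist({x, x′}, supp f))‖f‖_∞ (1.9)
… For some simple sets Ω, e.g. for rectangular parallelepipeds, the inequalities hold without any restrictions on the points x, x′.»
The constants are printed INDEPENDENT OF THE MASS (p. 572 (1.6): «m² ≥ 0 and a is a positive constant close to 1»); the tree's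
`thm19_zero_torus` fixes `m²` before producing `δ₀, c₀(α)` (its docstring: «functions of d, L, a, m² and α only»), although its
inputs `kerBounds_torus` ((2.35), (2.37)) and `holder236_torus` ((2.36)) are already uniform under the mass cap `(L^jε)²m² ≤ m²₊`
and the only other mass-dependent constant, the `C^{(0)}` decay rate `dK0 d L a m²` of `B5Leaf237C0Torus`, is ANTITONE in `m²`
(`B4Thm110ZeroTorus.dK0_antitone`).

## WHAT THIS FILE CERTIFIES (kernel-checked, zero `sorry`)

* **`thm19_zero_torus_unif`**: for `d ≥ 1`, odd `L > 1`, `a > 0` and a MASS CAP `m₀² ≥ 0` there is `δ₀ > 0` and, for every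
  `0 ≤ α < 1`, a `c₀(α) > 0` (functions of `d, L, a, m₀²` and `α` only) such that for EVERY mass `0 ≤ m² ≤ m₀²`, every volume
  `(d, L, m, K)`, every scale `1 ≤ k ≤ K`, every direction `μ`, all fine sites `x₁ ≠ x₂` and every source `f` with `|f| ≤ F`
  vanishing within fine sup-distance `D ≥ 0` of both `x₁` and `x₂`:
  `|x₁ − x₂|_η^{−α}·|(∂^ε_μG^ε_kf)(x₂) − (∂^ε_μG^ε_kf)(x₁)| ≤ c₀e^{−δ₀·εD}F` — the proof of `thm19_zero_torus` verbatim with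
  `kerBounds_torus … m₀²`, `holder236_torus … m₀²` (their cap condition `(L^jε)²m² ≤ m₀²` holds since `L^jε ≤ 1` for `j ≤ K`) and
  the `C^{(0)}` rate taken at the cap (`dK0 d L a m₀² ≤ dK0 d L a m²`).
* `thm19_zero_torus_unif'`: the same with both constants after `α` (`∀ α, ∃ δ₀ c₀`), the form the King-spelling consumer reads.

NOT COVERED: `A ≠ 0`; `α < 0` (false, `B4Thm19ZeroBoxNegAlpha`) and `α = 1`; boxes (the `B4Thm19ZeroBox*` lineage); general `Ω`.
HONEST FRAMING: statement-level reproduction of a published theorem at `A = 0` on finite tori; nothing here is a claim about the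
Yang–Mills mass gap; count-neutral.
-/

namespace Literature.MathematicalPhysics.QuantumFieldTheory.Balaban1983to89

namespace B4Thm19ZeroTorus

open Matrix B1RG242Torus B5Display136Torus B5Leaf237C0Torus B4Ineq115Torus B5Ineq137Torus B4Ineq116Torus
open B4Thm110ZeroTorus

noncomputable section

section MassUniform

/-- **B4 THEOREM (1.9) ON THE TORUS AT `A = 0` — THE HÖLDER CLAUSE, CONSTANTS UNIFORM IN THE MASS UNDER A CAP.**  For `d ≥ 1`, odd
`L > 1`, `a > 0` and `m₀² ≥ 0` there is `δ₀ > 0` and, for every `0 ≤ α < 1`, a `c₀ = c₀(α) > 0` (functions of `d, L, a, m₀²` and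
`α` only: «independent of A, k, Ω and depending on d, M only, c₀ on α also») such that for EVERY mass `0 ≤ m² ≤ m₀²`, every volume
`P = (d, L, m, K)` of Bałaban's scalar torus tower with these `d, L`, every level `1 ≤ k ≤ K`, every direction `μ`, all fine sites
`x₁ ≠ x₂` and every source `f` with `|f| ≤ F` vanishing within fine sup-distance `D ≥ 0` of both `x₁` and `x₂`:
`|x₁ − x₂|_η^{−α}·|(∂^ε_μG^ε_kf)(x₂) − (∂^ε_μG^ε_kf)(x₁)| ≤ c₀e^{−δ₀·εD}F`, `|x₁−x₂|_η = ε|x₁−x₂|_T`.  ROUTE: the proof of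
`thm19_zero_torus` ((2.34), (2.38)–(2.39), Lemma 2.4 on the torus, the `C^{(0)}` kernel; `holder_row_bound`) with the kernel
hypotheses `kerBounds_torus`, `holder236_torus` taken at the cap `m₀²` and the `C^{(0)}` rate `dK0 d L a m₀² ≤ dK0 d L a m²`
(`dK0_antitone`).
[cite: Balaban1983RegularityDecay, Theorem (1.9) p.573 («constants … depending on d, M only, c₀ on α also»), (2.34)–(2.39) pp.582–584,
Lemma 2.4 p.582, p.572 (torus); Balaban1984PropagatorsI p.39 («with □ replaced by the whole torus»)] -/
theorem thm19_zero_torus_unif (d L : ℕ) (hd : 1 ≤ d) (hL : Odd L ∧ 1 < L) {a : ℝ} (ha : 0 < a) {m0sq : ℝ}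
    (hm0 : 0 ≤ m0sq) :
    ∃ δ₀ : ℝ, 0 < δ₀ ∧ ∀ {α : ℝ}, 0 ≤ α → α < 1 → ∃ c₀ : ℝ, 0 < c₀ ∧ ∀ (P : Params), P.d = d → P.L = L →
      ∀ (msq : ℝ), 0 ≤ msq → msq ≤ m0sq →
      ∀ k : ℕ, 1 ≤ k → k ≤ P.K → ∀ (μ : Fin P.d) (x₁ x₂ : Site P 0), x₂ ≠ x₁ →
        ∀ (f : Site P 0 → ℝ) (F D : ℝ), (∀ z, |f z| ≤ F) → 0 ≤ D →
          (∀ z, f z ≠ 0 → D ≤ T P 0 x₁ z) → (∀ z, f z ≠ 0 → D ≤ T P 0 x₂ z) →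
            ((P.eps * T P 0 x₁ x₂)⁻¹) ^ α *
                |((deriv P 0 P.eps μ * (tower P a msq).G k) *ᵥ f) x₂ -
                  ((deriv P 0 P.eps μ * (tower P a msq).G k) *ᵥ f) x₁|
              ≤ c₀ * Real.exp (-(δ₀ * (P.eps * D))) * F := by
  obtain ⟨C, δK, hC, hδK, hK⟩ := kerBounds_torus d L hd hL ha m0sq
  obtain ⟨δH, hδH, hH⟩ := B4Lemma24TorusScales.holder236_torus d L hd hL ha m0sq
  obtain ⟨δ, hδK', hδH', hδ⟩ : ∃ δ : ℝ, δ ≤ δK ∧ δ ≤ δH ∧ 0 < δ :=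
    ⟨min δK δH, min_le_left _ _, min_le_right _ _, lt_min hδK hδH⟩
  -- the j = 0 constants at the cap depend on d, L, a, m₀² only; read them off any volume with these d, L
  obtain ⟨P₀, hP₀d, hP₀L⟩ : ∃ P₀ : Params, P₀.d = d ∧ P₀.L = L := ⟨⟨d, L, 0, 0, hd, hL⟩, rfl, rfl⟩
  set C₀ := 2 / gamma0 L a with hC₀def
  set δ₀ := dK0 d L a m0sq with hδ₀def
  have hC₀ : 0 ≤ C₀ := by
    rw [hC₀def, ← hP₀L]; exact (div_pos two_pos (gamma0_pos (P := P₀) ha)).le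
  have hδ₀ : 0 < δ₀ := by rw [hδ₀def, ← hP₀d, ← hP₀L]; exact dK0_pos (P := P₀) ha hm0
  have hL1 : (1 : ℝ) < L := by exact_mod_cast hL.2
  refine ⟨min (δ₀ / 2) (δ / 4), lt_min (by positivity) (by positivity), fun {α} hα0 hα1 => ?_⟩
  obtain ⟨c₁, hc₁, hH1⟩ := hH hα0 hα1
  have hLα : 0 < (L : ℝ) ^ (1 - α) - 1 := by
    have := Real.one_lt_rpow hL1 (by linarith : (0 : ℝ) < 1 - α)
    linarith
  have h1 := B4Sect5Proof.latticeConst_nonneg d (show 0 ≤ δ₀ / 2 by positivity)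
  have h2 := B4Sect5Proof.latticeConst_nonneg d (show 0 ≤ δ / 2 by positivity)
  have h2' := B4Sect5Proof.latticeConst_nonneg d (show 0 ≤ δ / 4 by positivity)
  have hc₁' := hc₁.le
  have h3 : 0 ≤ 1 / ((L : ℝ) ^ (1 - α) - 1) := (div_pos one_pos hLα).le
  refine ⟨4 * C₀ * Real.exp δ₀ * B4Sect5Proof.latticeConst d (δ₀ / 2) +
      a ^ 2 * (2 * c₁ * Real.exp δ * (C ^ 2 * B4Sect5Proof.latticeConst d (δ / 2) ^ 2 *
        (Real.exp (δ / 2) * B4Sect5Proof.latticeConst d (δ / 4)))) * (1 / ((L : ℝ) ^ (1 - α) - 1)) + 1,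
    by positivity, ?_⟩
  intro P hPd hPL msq hmsq hmcap k hk1 hkK μ x₁ x₂ hne f F D hF hD0 hD₁ hD₂
  have hkm : k ≤ P.m + P.K := hkK.trans (Nat.le_add_left _ _)
  -- the cap condition of the kernel inputs: `(L^jε)²m² ≤ m² ≤ m₀²` for `j ≤ K`
  have hcap : ∀ j, j ≤ P.K → P.spacing j ^ 2 * msq ≤ m0sq := by
    intro j hjK
    have hs1 : P.spacing j ≤ 1 := by rw [← P.spacing_K]; exact spacing_le_spacing P hjK
    calc P.spacing j ^ 2 * msq ≤ 1 * msq :=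
          mul_le_mul_of_nonneg_right (pow_le_one₀ (P.spacing_pos j).le hs1) hmsq
      _ = msq := one_mul _
      _ ≤ m0sq := hmcap
  have hKB : KerBounds P a msq k C δ :=
    KerBounds.mono P hC (hK P hPd hPL msq hmsq k hkm (hcap k hkK)) le_rfl hδK'
  have hHB : ∀ j : ℕ, 1 ≤ j → j < k → ∀ y : Site P j, ((P.L : ℝ) ^ j / T P 0 x₁ x₂) ^ α *
      |K1 P a msq j μ x₂ ⟨j, y⟩ - K1 P a msq j μ x₁ ⟨j, y⟩|
        ≤ c₁ * Real.exp (-(δ * min (dXU P j x₁ ⟨j, y⟩) (dXU P j x₂ ⟨j, y⟩))) := by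
    intro j hj1 hjk y
    have h := hH1 P hPd hPL msq hmsq j hj1 (hjk.le.trans hkm) (hcap j (hjk.le.trans hkK)) μ x₁ x₂ hne y
    have hM0 : 0 ≤ min (dXU P j x₁ ⟨j, y⟩) (dXU P j x₂ ⟨j, y⟩) :=
      le_min (dXU_nonneg P j x₁ _) (dXU_nonneg P j x₂ _)
    have := mul_le_mul_of_nonneg_right hδH' hM0
    exact h.trans (mul_le_mul_of_nonneg_left (Real.exp_le_exp.mpr (by linarith)) hc₁.le)
  subst hPd hPL
  -- the `C^{(0)}` kernel at mass `m²` decays at least at the cap rate `δ₀ = dK0 … m₀² ≤ dK0 … m²`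
  have hG0 : ∀ x x' : Site P 0, |G0unit P a msq x x'| ≤ C₀ * Real.exp (-(δ₀ * T P 0 x x')) := by
    intro x x'
    refine (G0unit_decay (P := P) ha hmsq x x').trans (mul_le_mul_of_nonneg_left ?_ hC₀)
    exact Real.exp_le_exp.mpr (neg_le_neg (mul_le_mul_of_nonneg_right
      (dK0_antitone P.d P.L ha hmsq hmcap) (T_nonneg P 0 x x')))
  have hF0 : 0 ≤ F := (abs_nonneg _).trans (hF x₁)
  have hmain := holder_row_bound P ha hmsq hk1 hkK hkm hC hδ hC₀ hδ₀ hc₁.le hα0 hα1 hKB hG0 μ hne hHB f hF hD0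
    hD₁ hD₂
  refine hmain.trans (mul_le_mul_of_nonneg_right (mul_le_mul_of_nonneg_right (by linarith) (Real.exp_pos _).le) hF0)

/-- **The same with both constants after `α`** (`∀ 0 ≤ α < 1, ∃ δ₀ c₀ > 0, …`): the quantifier shape the King-spelling consumer
`King1986.Torus.fineOp_inv_deriv_holder_le_unif` reads (the rate does not depend on `α`, but nothing downstream needs that).
[cite: Balaban1983RegularityDecay, Theorem (1.9) p.573] -/
theorem thm19_zero_torus_unif' (d L : ℕ) (hd : 1 ≤ d) (hL : Odd L ∧ 1 < L) {a : ℝ} (ha : 0 < a) {m0sq : ℝ}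
    (hm0 : 0 ≤ m0sq) {α : ℝ} (hα0 : 0 ≤ α) (hα1 : α < 1) :
    ∃ δ₀ c₀ : ℝ, 0 < δ₀ ∧ 0 < c₀ ∧ ∀ (P : Params), P.d = d → P.L = L →
      ∀ (msq : ℝ), 0 ≤ msq → msq ≤ m0sq →
      ∀ k : ℕ, 1 ≤ k → k ≤ P.K → ∀ (μ : Fin P.d) (x₁ x₂ : Site P 0), x₂ ≠ x₁ →
        ∀ (f : Site P 0 → ℝ) (F D : ℝ), (∀ z, |f z| ≤ F) → 0 ≤ D →
          (∀ z, f z ≠ 0 → D ≤ T P 0 x₁ z) → (∀ z, f z ≠ 0 → D ≤ T P 0 x₂ z) →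
            ((P.eps * T P 0 x₁ x₂)⁻¹) ^ α *
                |((deriv P 0 P.eps μ * (tower P a msq).G k) *ᵥ f) x₂ -
                  ((deriv P 0 P.eps μ * (tower P a msq).G k) *ᵥ f) x₁|
              ≤ c₀ * Real.exp (-(δ₀ * (P.eps * D))) * F := by
  obtain ⟨δ₀, hδ₀, H⟩ := thm19_zero_torus_unif d L hd hL ha hm0
  obtain ⟨c₀, hc₀, H'⟩ := H hα0 hα1
  exact ⟨δ₀, c₀, hδ₀, hc₀, H'⟩

end MassUniform

end

end B4Thm19ZeroTorus

end Literature.MathematicalPhysics.QuantumFieldTheory.Balaban1983to89
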